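import Mathlib.Analysis.Complex.Basic
import Mathlib.Analysis.Complex.Convex
import Literature.Probability.LatticeModels.MeshDomainBulk
import Literature.Probability.LatticeModels.DobrushinDiscretisation
import Literature.Probability.LatticeModels.BoundaryValues
import HarnessLib

/-!
# Flat pieces of the wired arc are discretised flatly: stub `stub_kernel_flatPieceGeometry`
(FLAT-GEOM) of line `hitting-tournament` for crux `LagHandOff` (stmt-CriticalPhenomena-10268)

Geometric input of the flat boundary kernel (seat c6).  Let `(D; a, b)` be a Dobrushin domain
with Lebesgue-null boundary, discretised by square-lattice Dobrushin data `E δ`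
(`ZdDiscretisationFamily`, `DobrushinDiscretisation.lean`), and let a piece of `∂D` be FLAT and
horizontal with the domain above: the open slab `(a₁, a₂) × (y₀, y₀ + η)` lies in `D`, the
half-closed slab `(a₁, a₂) × (y₀ - η, y₀]` misses `D`, and the closed upper slab stays at
distance `≥ η` from the other arc `D.arc 1`.  Then for all small meshes `δ` and every lattice
box of columns `j - M, …, j + N + M` with horizontal margin `η` inside `(a₁, a₂)`, of rows
`b - 1, …, b + M` where `b - 1 = ⌊y₀ / δ⌋ + 1` is the first row strictly above height `y₀`, and
with `(M + 3) δ ≤ η / 2`: (F1) every box site is a vertex of `Ω_δ = meshDomain`, lies on the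
discrete wired arc `zdArcA` iff it is on the bottom row, and never lies on the discrete free
arc `zdArcB`; (F3) `ℤ²`-neighbours inside the box are adjacent in `Ω_δ = discreteDomainGraph`.

Proof (fixed small mesh).  The sites of the box enlarged by one column on each side and one
row on top have mesh points in the open slab; each is joined to a lattice point of the compact
`K = [a₁ + η/2, a₂ - η/2] × [y₀ + η/4, y₀ + η/2] ⊆ D` by a vertical mesh path inside the slab,
so lies in `Ω_δ` for small `δ` (`eventually_mem_meshDomain_of_reachable`, `MeshDomainBulk.lean`,
using the null boundary); two `ℤ²`-neighbours of the enlarged box are `Ω_δ`-adjacent since the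
segment between their mesh points lies in the convex slab.  Hence a box site of row `≥ b` has
its four neighbours `Ω_δ`-adjacent and all incident faces inner: it is off
`zdBoundary ⊇ zdArcA`.  A bottom-row site has its lower neighbour (height
`⌊y₀/δ⌋ δ ∈ (y₀ - δ, y₀]`) outside `D`, so it is in `meshBoundary ⊆ zdBoundary ⊆ zdArcA ∪ zdArcB`
(eventual admissibility).  No box site `x` is in `zdArcB`: every point of the label set
`(E δ).arcB` is within `η/2` of `D.arc 1` (Hausdorff convergence `tendsto_arcB`), so
`infDist (δx) arcB ≥ η/2`, while the frontier point `(δ x₀, y₀)` below `x` is off `arcB` and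
within `(M + 2) δ < η/2` of `δx`, violating the defining inequality of `zdDiscreteArc arcB`.
-/

noncomputable section

open MeasureTheory Filter Set Topology Metric
open Literature.Probability.Percolation Literature.Probability.LatticeModels
open Literature.Probability.RandomPlanarGeometry

namespace Summit.CriticalPhenomena.CardyFormulaZ2.Cruxes.LagHandOff.HittingTournament

namespace KernelFlatGeometry

/-! ### Lattice bookkeeping -/

/-- Two `ℤ²`-neighbours differ by at most one in each coordinate. -/
theorem adj_coord_bounds {x y : Site 2} (h : (zdGraph 2).Adj x y) :
    x 0 - 1 ≤ y 0 ∧ y 0 ≤ x 0 + 1 ∧ x 1 - 1 ≤ y 1 ∧ y 1 ≤ x 1 + 1 := by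
  obtain ⟨i, h | h⟩ := (zdGraph_adj_iff x y).1 h
  · have h0 := congrFun h 0; have h1 := congrFun h 1
    fin_cases i <;> simp at h0 h1 <;> omega
  · have h0 := congrFun h 0; have h1 := congrFun h 1
    fin_cases i <;> simp at h0 h1 <;> omega

/-- A site is `ℤ²`-adjacent to the site just below it. -/
theorem adj_below (v : Site 2) : (zdGraph 2).Adj v ![v 0, v 1 - 1] := by
  refine (zdGraph_adj_iff _ _).2 ⟨1, Or.inr ?_⟩
  funext i; fin_cases i <;> simp

/-! ### Heights of lattice rows -/

/-- The row `⌊y₀ / δ⌋` has height in `(y₀ - δ, y₀]`. -/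
theorem floor_row_bounds {δ : ℝ} (hδ : 0 < δ) (y₀ : ℝ) :
    δ * (⌊y₀ / δ⌋ : ℝ) ≤ y₀ ∧ y₀ < δ * (⌊y₀ / δ⌋ : ℝ) + δ := by
  have h1 := mul_le_mul_of_nonneg_left (Int.floor_le (y₀ / δ)) hδ.le
  have h2 := mul_lt_mul_of_pos_left (Int.lt_floor_add_one (y₀ / δ)) hδ
  rw [mul_div_cancel₀ _ hδ.ne'] at h1
  rw [mul_add, mul_div_cancel₀ _ hδ.ne', mul_one] at h2
  exact ⟨h1, h2⟩

/-- The row `⌈t / δ⌉` has height in `[t, t + δ)`. -/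
theorem ceil_row_bounds {δ : ℝ} (hδ : 0 < δ) (t : ℝ) :
    t ≤ δ * (⌈t / δ⌉ : ℝ) ∧ δ * (⌈t / δ⌉ : ℝ) < t + δ := by
  have h1 := mul_le_mul_of_nonneg_left (Int.le_ceil (t / δ)) hδ.le
  have h2 := mul_lt_mul_of_pos_left (Int.ceil_lt_add_one (t / δ)) hδ
  rw [mul_div_cancel₀ _ hδ.ne'] at h1
  rw [mul_add, mul_div_cancel₀ _ hδ.ne', mul_one] at h2
  exact ⟨h1, h2⟩

/-- Coordinates of the sites of the enlarged box (one extra column on each side, rows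
`⌊y₀/δ⌋ + 1, …, ⌊y₀/δ⌋ + M + 3`): abscissa in `[a₁ + η - δ, a₂ - η + δ]`, height in
`(y₀, y₀ + η / 2]`. -/
theorem slab_bounds {δ a₁ a₂ y₀ η : ℝ} (hδ : 0 < δ) {j : ℤ} {N M : ℕ}
    (h1 : a₁ + η ≤ ((j - M : ℤ) : ℝ) * δ) (h2 : ((j + N + M : ℤ) : ℝ) * δ ≤ a₂ - η)
    (h3 : ((M : ℝ) + 3) * δ ≤ η / 2) {x : Site 2}
    (hx0 : j - M - 1 ≤ x 0) (hx0' : x 0 ≤ j + N + M + 1)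
    (hx1 : ⌊y₀ / δ⌋ + 1 ≤ x 1) (hx1' : x 1 ≤ ⌊y₀ / δ⌋ + M + 3) :
    a₁ + η - δ ≤ δ * x 0 ∧ δ * x 0 ≤ a₂ - η + δ ∧ y₀ < δ * x 1 ∧ δ * x 1 ≤ y₀ + η / 2 := by
  have e1 : ((j - M - 1 : ℤ) : ℝ) ≤ x 0 := Int.cast_le.2 hx0
  have e2 : (x 0 : ℝ) ≤ ((j + N + M + 1 : ℤ) : ℝ) := Int.cast_le.2 hx0'
  have e3 : ((⌊y₀ / δ⌋ + 1 : ℤ) : ℝ) ≤ x 1 := Int.cast_le.2 hx1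
  have e4 : (x 1 : ℝ) ≤ ((⌊y₀ / δ⌋ + M + 3 : ℤ) : ℝ) := Int.cast_le.2 hx1'
  push_cast at h1 h2 e1 e2 e3 e4
  obtain ⟨f1, f2⟩ := floor_row_bounds hδ y₀
  have m1 := mul_le_mul_of_nonneg_left e1 hδ.le
  have m2 := mul_le_mul_of_nonneg_left e2 hδ.le
  have m3 := mul_le_mul_of_nonneg_left e3 hδ.le
  have m4 := mul_le_mul_of_nonneg_left e4 hδ.le
  exact ⟨by linarith, by linarith, by linarith, by linarith⟩

/-! ### Planar geometry of the slab -/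

/-- The open slab is convex. -/
theorem convex_slab (a₁ a₂ y₀ η : ℝ) :
    Convex ℝ {z : ℂ | a₁ < z.re ∧ z.re < a₂ ∧ y₀ < z.im ∧ z.im < y₀ + η} := by
  have : {z : ℂ | a₁ < z.re ∧ z.re < a₂ ∧ y₀ < z.im ∧ z.im < y₀ + η} =
      ({z : ℂ | a₁ < z.re} ∩ {z : ℂ | z.re < a₂}) ∩
        ({z : ℂ | y₀ < z.im} ∩ {z : ℂ | z.im < y₀ + η}) := by
    ext z
    simp only [mem_inter_iff, mem_setOf_eq, and_assoc]
  rw [this]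
  exact ((convex_halfSpace_re_gt _).inter (convex_halfSpace_re_lt _)).inter
    ((convex_halfSpace_im_gt _).inter (convex_halfSpace_im_lt _))

/-- The point `(t, y₀)` under the flat piece (`a₁ < t < a₂`) is a frontier point of `Ω`: it is
not in `Ω` (half-closed lower slab) but is a limit of points of the open slab above it. -/
theorem mk_mem_frontier {Ω : Set ℂ} {a₁ a₂ y₀ η t : ℝ} (hη : 0 < η)
    (hslab : {z : ℂ | a₁ < z.re ∧ z.re < a₂ ∧ y₀ < z.im ∧ z.im < y₀ + η} ⊆ Ω)
    (hbelow : ∀ z : ℂ, a₁ < z.re → z.re < a₂ → y₀ - η < z.im → z.im ≤ y₀ → z ∉ Ω)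
    (h1 : a₁ < t) (h2 : t < a₂) : (⟨t, y₀⟩ : ℂ) ∈ frontier Ω := by
  refine ⟨?_, fun h => hbelow ⟨t, y₀⟩ h1 h2 (show y₀ - η < y₀ by linarith) le_rfl
    (interior_subset h)⟩
  rw [Metric.mem_closure_iff]
  intro ε hε
  have hm := lt_min (half_pos hε) (half_pos hη)
  have hm' := min_le_left (ε / 2) (η / 2); have hm'' := min_le_right (ε / 2) (η / 2)
  refine ⟨⟨t, y₀ + min (ε / 2) (η / 2)⟩, hslab ⟨h1, h2, ?_, ?_⟩, ?_⟩
  · show y₀ < y₀ + min (ε / 2) (η / 2); linarith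
  · show y₀ + min (ε / 2) (η / 2) < y₀ + η; linarith
  · rw [Complex.dist_of_re_eq (z := ⟨t, y₀⟩) (w := ⟨t, y₀ + min (ε / 2) (η / 2)⟩) rfl,
      Real.dist_eq]
    show |y₀ - (y₀ + min (ε / 2) (η / 2))| < ε
    rw [abs_of_nonpos (by linarith)]; linarith

/-- The distance from a mesh point to the point straight below it at height `y₀`. -/
theorem dist_meshPoint_mk (δ y₀ : ℝ) (x : Site 2) :
    dist (meshPoint δ x) (⟨δ * x 0, y₀⟩ : ℂ) = |δ * x 1 - y₀| := by
  rw [Complex.dist_of_re_eq (by simp), Real.dist_eq, meshPoint_im]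

/-! ### The discrete domain near the flat piece -/

/-- A mesh vertex joined to an anchor site `k` of the same column, whose mesh point lies in the
bulk compact `K`, by a vertical column of `Ω` belongs to `Ω_δ` (staircase lemma plus the bulk
property `hreach` of `MeshDomainBulk.lean`). -/
theorem mem_meshDomain_of_column {Ω K : Set ℂ} {δ : ℝ} (hδ : 0 < δ)
    (hreach : ∀ (x y : Site 2) (hx : x ∈ meshVertices Ω δ) (hy : y ∈ meshVertices Ω δ),
      meshPoint δ x ∈ K → (meshVertexGraph Ω δ).Reachable ⟨x, hx⟩ ⟨y, hy⟩ → y ∈ meshDomain Ω δ)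
    {k x : Site 2} (hk0 : k 0 = x 0) (hkK : meshPoint δ k ∈ K)
    (hcol : ∀ z : ℂ, z.re = δ * x 0 → z.im ∈ uIcc (δ * k 1) (δ * x 1) → z ∈ Ω) :
    x ∈ meshDomain Ω δ := by
  have hkΩ : k ∈ meshVertices Ω δ :=
    hcol _ (by rw [meshPoint_re, hk0]) (by rw [meshPoint_im]; exact left_mem_uIcc)
  have hxΩ : x ∈ meshVertices Ω δ :=
    hcol _ (by rw [meshPoint_re]) (by rw [meshPoint_im]; exact right_mem_uIcc)
  refine hreach k x hkΩ hxΩ hkK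
    (meshVertexGraph_reachable_of_rectangle_subset hδ _ k x rfl ?_ hkΩ hxΩ)
  intro z hz
  have hre : z.re ∈ uIcc (meshPoint δ k).re (meshPoint δ x).re := hz.1
  have him : z.im ∈ uIcc (meshPoint δ k).im (meshPoint δ x).im := hz.2
  rw [meshPoint_re, meshPoint_re, hk0, uIcc_self, mem_singleton_iff] at hre
  rw [meshPoint_im, meshPoint_im] at him
  exact hcol z hre him

/-- A site all of whose `ℤ²`-neighbours within coordinate distance one are mutually
`Ω_δ`-adjacent (whenever `ℤ²`-adjacent) is not in the square-lattice discrete boundary: its four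
neighbours are joined to it in `Ω_δ` and every face at it is an inner face. -/
theorem notMem_zdBoundary {E' : DiscreteDobrushin} {x : Site 2}
    (hadj : ∀ v w : Site 2, x 0 - 1 ≤ v 0 → v 0 ≤ x 0 + 1 → x 1 - 1 ≤ v 1 → v 1 ≤ x 1 + 1 →
      x 0 - 1 ≤ w 0 → w 0 ≤ x 0 + 1 → x 1 - 1 ≤ w 1 → w 1 ≤ x 1 + 1 →
      (zdGraph 2).Adj v w → (discreteDomainGraph E'.Ω E'.δ).Adj v w) :
    x ∉ E'.zdBoundary := by
  rintro (⟨-, y, hxy, hny⟩ | ⟨y, -, -, f, hf, hxf, -⟩)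
  · obtain ⟨b1, b2, b3, b4⟩ := adj_coord_bounds hxy
    exact hny (hadj x y (by omega) (by omega) (by omega) (by omega) b1 b2 b3 b4 hxy)
  · refine hf fun v w hv hw hvw => ?_
    have hx0 := hxf 0; have hx1 := hxf 1
    have hv0 := hv 0; have hv1 := hv 1; have hw0 := hw 0; have hw1 := hw 1
    exact hadj v w (by omega) (by omega) (by omega) (by omega) (by omega) (by omega) (by omega)
      (by omega) hvw

/-- **Off the free arc.** If every point of the label set `arcB` is within `η/2` of a set `T`,
the mesh point of `x` is at distance `≥ η` from `T`, and some frontier point `p` at distance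
`≥ η` from `T` is within `< η/2` of the mesh point of `x`, then `x ∉ zdArcB`: the mesh point is
`≥ η/2` away from `arcB` but `< η/2` away from `∂Ω ∖ arcB ∋ p`. -/
theorem notMem_zdArcB {E' : DiscreteDobrushin} {Ω T : Set ℂ} {δ η : ℝ}
    (hΩ' : E'.Ω = Ω) (hδ' : E'.δ = δ) (hη : 0 < η) (hne : E'.arcB.Nonempty)
    (hT : ∀ y ∈ E'.arcB, ∃ y' ∈ T, dist y y' < η / 2) {x : Site 2} {p : ℂ}
    (hx : η ≤ infDist (meshPoint δ x) T) (hp : p ∈ frontier Ω) (hpT : η ≤ infDist p T)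
    (hpx : dist (meshPoint δ x) p < η / 2) : x ∉ E'.zdArcB := by
  intro h
  have h' : x ∈ E'.zdDiscreteArc E'.arcB := h
  rw [DiscreteDobrushin.mem_zdDiscreteArc_iff, hΩ', hδ'] at h'
  have hpB : p ∉ E'.arcB := fun hpB => by
    obtain ⟨y', hy', hd⟩ := hT p hpB
    have := infDist_le_dist_of_mem (x := p) hy'
    linarith
  have hR : infDist (meshPoint δ x) (frontier Ω \ E'.arcB) < η / 2 :=
    (infDist_le_dist_of_mem (show p ∈ frontier Ω \ E'.arcB from ⟨hp, hpB⟩)).trans_lt hpx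
  have hL : η / 2 ≤ infDist (meshPoint δ x) E'.arcB := by
    refine (le_infDist hne).2 fun y hy => ?_
    obtain ⟨y', hy', hd⟩ := hT y hy
    have h1 := infDist_le_dist_of_mem (x := meshPoint δ x) hy'
    have h2 := dist_triangle (meshPoint δ x) y y'
    linarith
  linarith [h'.2]

/-- **The flat piece at a fixed small mesh.**  Deterministic core of
`stub_kernel_flatPieceGeometry`: for Dobrushin data `E'` on the domain `Ω` at mesh `δ` that are
admissible, whose label set `arcB` is pointwise within `η/2` of `T`, and such that mesh paths
from the lattice points of the bulk compact `K` stay in `Ω_δ` (`hreach`), the conclusions (F1),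
(F3) hold for every lattice box as in the statement. -/
theorem flatPiece_core {Ω T : Set ℂ} {δ a₁ a₂ y₀ η : ℝ} {E' : DiscreteDobrushin}
    (hΩ' : E'.Ω = Ω) (hδ' : E'.δ = δ) (hδ : 0 < δ) (hη : 0 < η)
    (hslab : {z : ℂ | a₁ < z.re ∧ z.re < a₂ ∧ y₀ < z.im ∧ z.im < y₀ + η} ⊆ Ω)
    (hbelow : ∀ z : ℂ, a₁ < z.re → z.re < a₂ → y₀ - η < z.im → z.im ≤ y₀ → z ∉ Ω)
    (hfar : ∀ z : ℂ, a₁ ≤ z.re → z.re ≤ a₂ → y₀ ≤ z.im → z.im ≤ y₀ + η → η ≤ infDist z T)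
    (hadm : E'.IsZdAdmissible) (hT : ∀ y ∈ E'.arcB, ∃ y' ∈ T, dist y y' < η / 2)
    (hreach : ∀ (x y : Site 2) (hx : x ∈ meshVertices Ω δ) (hy : y ∈ meshVertices Ω δ),
      meshPoint δ x ∈ (Icc (a₁ + η / 2) (a₂ - η / 2) ×ℂ Icc (y₀ + η / 4) (y₀ + η / 2)) →
      (meshVertexGraph Ω δ).Reachable ⟨x, hx⟩ ⟨y, hy⟩ → y ∈ meshDomain Ω δ)
    (j : ℤ) (N M : ℕ) (h1 : a₁ + η ≤ ((j - M : ℤ) : ℝ) * δ)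
    (h2 : ((j + N + M : ℤ) : ℝ) * δ ≤ a₂ - η) (h3 : ((M : ℝ) + 3) * δ ≤ η / 2) :
    (∀ v : Site 2, j - M ≤ v 0 → v 0 ≤ j + N + M → (⌊y₀ / δ⌋ + 2) - 1 ≤ v 1 →
        v 1 ≤ (⌊y₀ / δ⌋ + 2) + M →
        v ∈ meshDomain E'.Ω E'.δ ∧ (v ∈ E'.zdArcA ↔ v 1 = (⌊y₀ / δ⌋ + 2) - 1) ∧
          v ∉ E'.zdArcB) ∧
    (∀ v w : Site 2, j - M ≤ v 0 → v 0 ≤ j + N + M → (⌊y₀ / δ⌋ + 2) - 1 ≤ v 1 →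
        v 1 ≤ (⌊y₀ / δ⌋ + 2) + M → j - M ≤ w 0 → w 0 ≤ j + N + M →
        (⌊y₀ / δ⌋ + 2) - 1 ≤ w 1 → w 1 ≤ (⌊y₀ / δ⌋ + 2) + M →
        (zdGraph 2).Adj v w → (discreteDomainGraph E'.Ω E'.δ).Adj v w) := by
  have hδη : 3 * δ ≤ η / 2 := by nlinarith [(Nat.cast_nonneg M : (0 : ℝ) ≤ M)]
  obtain ⟨f1, f2⟩ := floor_row_bounds hδ y₀
  -- coordinates of the sites of the enlarged box
  have hS : ∀ x : Site 2, j - M - 1 ≤ x 0 → x 0 ≤ j + N + M + 1 → ⌊y₀ / δ⌋ + 1 ≤ x 1 →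
      x 1 ≤ ⌊y₀ / δ⌋ + M + 3 →
      a₁ + η - δ ≤ δ * x 0 ∧ δ * x 0 ≤ a₂ - η + δ ∧ y₀ < δ * x 1 ∧ δ * x 1 ≤ y₀ + η / 2 :=
    fun x hx0 hx0' hx1 hx1' => slab_bounds hδ h1 h2 h3 hx0 hx0' hx1 hx1'
  have hSΩ : ∀ x : Site 2, j - M - 1 ≤ x 0 → x 0 ≤ j + N + M + 1 → ⌊y₀ / δ⌋ + 1 ≤ x 1 →
      x 1 ≤ ⌊y₀ / δ⌋ + M + 3 →
      meshPoint δ x ∈ {z : ℂ | a₁ < z.re ∧ z.re < a₂ ∧ y₀ < z.im ∧ z.im < y₀ + η} := by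
    intro x hx0 hx0' hx1 hx1'
    obtain ⟨c1, c2, c3, c4⟩ := hS x hx0 hx0' hx1 hx1'
    simp only [mem_setOf_eq, meshPoint_re, meshPoint_im]
    exact ⟨by linarith, by linarith, c3, by linarith⟩
  -- the enlarged box lies in `Ω_δ`
  have hD : ∀ x : Site 2, j - M - 1 ≤ x 0 → x 0 ≤ j + N + M + 1 → ⌊y₀ / δ⌋ + 1 ≤ x 1 →
      x 1 ≤ ⌊y₀ / δ⌋ + M + 3 → x ∈ meshDomain Ω δ := by
    intro x hx0 hx0' hx1 hx1'
    obtain ⟨c1, c2, c3, c4⟩ := hS x hx0 hx0' hx1 hx1'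
    obtain ⟨hc1, hc2⟩ := ceil_row_bounds hδ (y₀ + η / 4)
    refine mem_meshDomain_of_column hδ hreach (k := ![x 0, ⌈(y₀ + η / 4) / δ⌉]) (by simp) ?_ ?_
    · simp only [Complex.mem_reProdIm, meshPoint_re, meshPoint_im, Matrix.cons_val_zero,
        Matrix.cons_val_one, mem_Icc]
      exact ⟨⟨by linarith, by linarith⟩, hc1, by linarith⟩
    · intro z hre him
      apply hslab
      simp only [Matrix.cons_val_one, Matrix.cons_val_zero] at him
      simp only [mem_setOf_eq, hre]
      rcases mem_uIcc.1 him with ⟨l1, l2⟩ | ⟨l1, l2⟩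
      · exact ⟨by linarith, by linarith, by linarith, by linarith⟩
      · exact ⟨by linarith, by linarith, by linarith, by linarith⟩
  -- `ℤ²`-neighbours of the enlarged box are `Ω_δ`-adjacent
  have hA : ∀ v w : Site 2, j - M - 1 ≤ v 0 → v 0 ≤ j + N + M + 1 → ⌊y₀ / δ⌋ + 1 ≤ v 1 →
      v 1 ≤ ⌊y₀ / δ⌋ + M + 3 → j - M - 1 ≤ w 0 → w 0 ≤ j + N + M + 1 → ⌊y₀ / δ⌋ + 1 ≤ w 1 →
      w 1 ≤ ⌊y₀ / δ⌋ + M + 3 →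
      (zdGraph 2).Adj v w → (discreteDomainGraph E'.Ω E'.δ).Adj v w := by
    intro v w hv0 hv0' hv1 hv1' hw0 hw0' hw1 hw1' hvw
    rw [hΩ', hδ']
    exact discreteDomainGraph_adj_iff.2 ⟨meshGraph_adj_iff.2 ⟨hvw,
      ((convex_slab a₁ a₂ y₀ η).segment_subset (hSΩ v hv0 hv0' hv1 hv1')
        (hSΩ w hw0 hw0' hw1 hw1')).trans (hslab.trans subset_closure)⟩,
      hD v hv0 hv0' hv1 hv1', hD w hw0 hw0' hw1 hw1'⟩
  -- no site of the box lies on the discrete free arc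
  have hne : E'.arcB.Nonempty := hadm.arcB_nonempty
  have hB : ∀ x : Site 2, j - M ≤ x 0 → x 0 ≤ j + N + M → ⌊y₀ / δ⌋ + 1 ≤ x 1 →
      x 1 ≤ ⌊y₀ / δ⌋ + 2 + M → x ∉ E'.zdArcB := by
    intro x hx0 hx0' hx1 hx1'
    obtain ⟨c1, c2, c3, c4⟩ := hS x (by omega) (by omega) hx1 (by omega)
    have e4 : (x 1 : ℝ) ≤ ((⌊y₀ / δ⌋ + 2 + M : ℤ) : ℝ) := Int.cast_le.2 hx1'
    push_cast at e4
    have c5 : δ * x 1 ≤ y₀ + η / 2 - δ := by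
      have m4 := mul_le_mul_of_nonneg_left e4 hδ.le; linarith
    have hpf : (⟨δ * x 0, y₀⟩ : ℂ) ∈ frontier Ω :=
      mk_mem_frontier hη hslab hbelow (by linarith) (by linarith)
    have hpT : η ≤ infDist (⟨δ * x 0, y₀⟩ : ℂ) T := hfar _ (show a₁ ≤ δ * x 0 by linarith)
      (show δ * x 0 ≤ a₂ by linarith) (show y₀ ≤ y₀ from le_rfl) (show y₀ ≤ y₀ + η by linarith)
    have hxT : η ≤ infDist (meshPoint δ x) T :=
      hfar _ (by rw [meshPoint_re]; linarith) (by rw [meshPoint_re]; linarith)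
        (by rw [meshPoint_im]; linarith) (by rw [meshPoint_im]; linarith)
    have hpx : dist (meshPoint δ x) (⟨δ * x 0, y₀⟩ : ℂ) < η / 2 := by
      rw [dist_meshPoint_mk, abs_of_pos (by linarith)]; linarith
    exact notMem_zdArcB hΩ' hδ' hη hne hT hxT hpf hpT hpx
  refine ⟨fun v hv0 hv0' hv1 hv1' => ⟨?_, ⟨fun hvA => ?_, fun hrow => ?_⟩,
      hB v hv0 hv0' (by omega) (by omega)⟩,
    fun v w hv0 hv0' hv1 hv1' hw0 hw0' hw1 hw1' hvw =>
      hA v w (by omega) (by omega) (by omega) (by omega) (by omega) (by omega) (by omega)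
        (by omega) hvw⟩
  · -- (F1a) the box lies in `Ω_δ`
    rw [hΩ', hδ']
    exact hD v (by omega) (by omega) (by omega) (by omega)
  · -- (F1b, →) a wired site of the box is on the bottom row: higher rows miss `zdBoundary`
    by_contra hne'
    refine notMem_zdBoundary (E' := E') (x := v)
      (fun v' w' k0 k0' k1 k1' l0 l0' l1 l1' hadj => hA v' w' ?_ ?_ ?_ ?_ ?_ ?_ ?_ ?_ hadj)
      (E'.zdArcA_subset_zdBoundary hvA)
    all_goals omega
  · -- (F1b, ←) the bottom row is wired: its lower neighbours are outside `Ω`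
    have hvD : v ∈ meshDomain E'.Ω E'.δ := by
      rw [hΩ', hδ']
      exact hD v (by omega) (by omega) (by omega) (by omega)
    have huD : ![v 0, v 1 - 1] ∉ meshDomain E'.Ω E'.δ := by
      rw [hΩ', hδ']
      intro huD
      have hu := meshDomain_subset_meshVertices _ _ huD
      rw [mem_meshVertices_iff] at hu
      obtain ⟨c1, c2, c3, c4⟩ := hS v (by omega) (by omega) (by omega) (by omega)
      have hu1 : (((![v 0, v 1 - 1] : Site 2) 1 : ℤ) : ℝ) = ⌊y₀ / δ⌋ := by
        have : (![v 0, v 1 - 1] : Site 2) 1 = ⌊y₀ / δ⌋ := by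
          simp only [Matrix.cons_val_one, Matrix.cons_val_zero]
          omega
        exact_mod_cast this
      refine hbelow _ ?_ ?_ ?_ ?_ hu
      · rw [meshPoint_re]; simp only [Matrix.cons_val_zero]; linarith
      · rw [meshPoint_re]; simp only [Matrix.cons_val_zero]; linarith
      · rw [meshPoint_im, hu1]; linarith
      · rw [meshPoint_im, hu1]; exact f1
    have hvb : v ∈ E'.zdBoundary :=
      E'.meshBoundary_subset_zdBoundary (mem_meshBoundary_of_adj_not_mem hvD (adj_below v) huD)
    rcases hadm.zdBoundary_subset hvb with h | h
    · exact h
    · exact absurd h (hB v hv0 hv0' (by omega) (by omega))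

end KernelFlatGeometry

open KernelFlatGeometry in
/-- **FLAT-GEOM** (stub `stub_kernel_flatPieceGeometry` of line `hitting-tournament`, crux
`LagHandOff`).  Under a flat horizontal piece of the wired arc (domain above: the open slab
`(a₁, a₂) × (y₀, y₀ + η)` inside `D`, the half-closed slab below outside `D`, the closed upper
slab at distance `≥ η` from `D.arc 1`), along any `ℤ²`-discretisation family of a Dobrushin
domain with Lebesgue-null boundary, for all small meshes `δ` and every lattice box of columns
`j - M, …, j + N + M` (horizontal margin `η`) and rows `b - 1, …, b + M`, `b = ⌊y₀/δ⌋ + 2`,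
with `(M + 3) δ ≤ η / 2`: every box site is in `Ω_δ`, is on the discrete wired arc iff it is
on the bottom row `b - 1`, is never on the discrete free arc, and `ℤ²`-neighbours inside the box
are `Ω_δ`-adjacent. -/
theorem stub_kernel_flatPieceGeometry :
    ∀ (D : DobrushinDomain) (E : ℝ → DiscreteDobrushin), ZdDiscretisationFamily D E →
      volume (frontier D.carrier) = 0 →
      ∀ (a₁ a₂ y₀ η : ℝ), a₁ < a₂ → 0 < η →
        {z : ℂ | a₁ < z.re ∧ z.re < a₂ ∧ y₀ < z.im ∧ z.im < y₀ + η} ⊆ D.carrier →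
        (∀ z : ℂ, a₁ < z.re → z.re < a₂ → y₀ - η < z.im → z.im ≤ y₀ → z ∉ D.carrier) →
        (∀ z : ℂ, a₁ ≤ z.re → z.re ≤ a₂ → y₀ ≤ z.im → z.im ≤ y₀ + η →
          η ≤ Metric.infDist z (D.arc 1)) →
        ∀ᶠ δ in 𝓝[>] (0 : ℝ), ∀ (j : ℤ) (N M : ℕ),
          a₁ + η ≤ ((j - M : ℤ) : ℝ) * δ → ((j + N + M : ℤ) : ℝ) * δ ≤ a₂ - η →
          ((M : ℝ) + 3) * δ ≤ η / 2 →
          (∀ v : Site 2, j - M ≤ v 0 → v 0 ≤ j + N + M → (⌊y₀ / δ⌋ + 2) - 1 ≤ v 1 →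
              v 1 ≤ (⌊y₀ / δ⌋ + 2) + M →
              v ∈ meshDomain (E δ).Ω (E δ).δ ∧ (v ∈ (E δ).zdArcA ↔ v 1 = (⌊y₀ / δ⌋ + 2) - 1) ∧
                v ∉ (E δ).zdArcB) ∧
          (∀ v w : Site 2, j - M ≤ v 0 → v 0 ≤ j + N + M → (⌊y₀ / δ⌋ + 2) - 1 ≤ v 1 →
              v 1 ≤ (⌊y₀ / δ⌋ + 2) + M →
              j - M ≤ w 0 → w 0 ≤ j + N + M → (⌊y₀ / δ⌋ + 2) - 1 ≤ w 1 →
              w 1 ≤ (⌊y₀ / δ⌋ + 2) + M →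
              (zdGraph 2).Adj v w → (discreteDomainGraph (E δ).Ω (E δ).δ).Adj v w) := by
  intro D E hfam hnull a₁ a₂ y₀ η _ha hη hslab hbelow hfar
  have hKΩ : (Icc (a₁ + η / 2) (a₂ - η / 2) ×ℂ Icc (y₀ + η / 4) (y₀ + η / 2)) ⊆ D.carrier := by
    rintro z ⟨⟨h1, h2⟩, h3, h4⟩
    exact hslab ⟨by linarith, by linarith, by linarith, by linarith⟩
  have hH : ∀ᶠ δ in 𝓝[>] (0 : ℝ),
      hausdorffEDist (E δ).arcB (D.arc 1) < ENNReal.ofReal (η / 2) :=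
    hfam.tendsto_arcB (Iio_mem_nhds (ENNReal.ofReal_pos.2 (half_pos hη)))
  filter_upwards [eventually_mem_meshDomain_of_reachable D.isOpen D.isBounded D.isConnected
      hnull (isCompact_Icc.reProdIm isCompact_Icc) hKΩ, hH, hfam.eventually_isZdAdmissible,
    (self_mem_nhdsWithin : ∀ᶠ δ in 𝓝[>] (0 : ℝ), 0 < δ)]
    with δ hreach hHδ hadm hδ0 j N M h1 h2 h3
  have hT : ∀ y ∈ (E δ).arcB, ∃ y' ∈ D.arc 1, dist y y' < η / 2 := fun y hy => by
    obtain ⟨y', hy', hd⟩ := exists_edist_lt_of_hausdorffEDist_lt hy hHδ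
    exact ⟨y', hy', edist_lt_ofReal.1 hd⟩
  exact flatPiece_core (hfam.Ω_eq δ) (hfam.δ_eq δ) hδ0 hη hslab hbelow hfar hadm hT hreach
    j N M h1 h2 h3

end Summit.CriticalPhenomena.CardyFormulaZ2.Cruxes.LagHandOff.HittingTournament

end
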